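import Literature.Computability.QuantumComplexity.PauliPathTruncationClassXEB
import HarnessLib

/-!
# The state-level Pauli-path enumerator: frame-averaged fidelity and purity of the noisy framed
circuit, and the noisy XEB as its computational-basis (diagonal) part

THESIS. In the tree's frame model of a fixed layer sequence `U_0,…,U_{d-1}` with uniform Pauli frames
`W` and per-layer depolarizing rate `γ` (`PauliPath.frameLayers`, `noisyValue`, `avgXEB`), read every
Pauli path `s` out at its OWN last string: the STATE COEFFICIENT `g(C,s) := f(C,s; O = σ_{s_d})`
(`stateCoeff`); every path coefficient factors through it, `f(C,s;O) = 2^{-n} Tr(O σ_{s_d}) g(C,s)`, and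
bilinear frame orthogonality summed over the Pauli read-outs gives the MASTER IDENTITY (`sum_frame_frameOverlap`)
`Σ_W Tr(σ̃_W(γ₁) σ̃_W(γ₂)) = (4ⁿ)^{d+1} 2^{-n} Σ_s ((1−γ₁)(1−γ₂))^{|s|} g(C,s)²`,
where `σ̃_W(γ)` is the framed noisy state whose diagonal is the tree's `p̃_W` (`frameState`,
`trace_proj_mul_frameState`). With the STATE WEIGHTS `V_k := Σ_{|s|=k} g²` and STATE ENUMERATOR
`Ψ_C(t) := Σ_k t^k V_k`: frame-averaged fidelity `F̄_γ = 2^{-n} Ψ_C(1−γ)` (`avgFid_eq`) and purity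
`P̄_γ = 2^{-n} Ψ_C((1−γ)²)` (`avgPurity_eq`). The tree's XEB weights are EXACTLY the `Z`-type-ending part,
`w_s = [s_d ∈ {I,Z}ⁿ] g(C,s)²` (`pathWt_eq_ite_statePathWt`), so with the COHERENCE ENUMERATOR
`Ξ_C := Ψ_C − Φ_C ≥ 0` (paths ending off the diagonal, `cohWt_eq_sum`):
`2ⁿ F̄_γ = (E_W XEB_γ + 1) + Ξ_C(1−γ)` (`two_pow_mul_avgFid_eq`), `Ξ = 0` at `d = 0`; for unitary layers
`V_0 = 1`, `V_k = 0 (0<k≤d)`, `Σ_k V_k = 2ⁿ` (`stateEnumerator_one`), the band `t^{n(d+1)} (2ⁿ−1−α′) ≤ Ξ_C(t) ≤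
t^{d+1} (2ⁿ−1−α′)` (`cohEnumerator_sandwich`, `α′ = E_W XEB_0`) and the floor-regime row `avgFid_sandwich`.

DICTIONARY (print ↔ here). Gao et al. derive for Haar/2-design ENSEMBLES that "the XEB and the fidelity …
differ only by the boundary condition at the final time", per-site boundary vectors `v_XEB = (2, 2/3)` vs
`v_F = (1, 1)`: "XEB depends only on correlations measured in the computational basis constituting 1/3 of the
total on average" [cite: GaoEtAl2024, §4.2, arXiv pp. 16–18]. Here: a FIXED layer sequence, the uniform Pauli
frames of [cite: AharonovEtAl2023, Definition 3], and the exact endpoint rule `{I,Z}ⁿ` instead of the `1/3`.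

HONEST FRAMING. Identities and inequalities about the honest noisy circuit's OWN framed state in the tree's
model (fixed layer sequence, frame average, uniform depolarizing rate). "Fidelity" = `Tr(σ̃_W(0) σ̃_W(γ))` with
the ideal framed state — not any experiment's reported fidelity; no estimator, protocol or procedure is defined;
no sentence converts an XEB score into a fidelity beyond the typed identity and band. The sandwiches' upper
halves are per-instance folklore (unitary invariance, contraction of the traceless part); the identities, the
split and the floors are the model's. Nothing here bears on the complexity of random circuit sampling.

NOT RECORDED: the tangent floor `F̄_γ ≥ (1−γ)^{κ̄}`, `κ̄ := Ψ′(1)/Ψ(1)` (the move of `XEBMeanWeightExponentLaw`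
on `Ψ_C`) and its truncation-level reading; explicit small circuits with `Ξ > 0` (gate matrices outside the imports).
-/

noncomputable section

open Matrix Finset

namespace Literature.Computability.QuantumComplexity

namespace PauliPath.StateEnumerator

variable {ι : Type*} [Fintype ι] [DecidableEq ι] {d : ℕ}

/-- The STATE COEFFICIENT `g(C,s) := f(C,s; σ_{s_d})`, the path read out at its own last string (noiseless):
`(2^{-n})^{d} ∏_t Tr(σ_{s_{t+1}} U_t σ_{s_t} U_t†) · Tr(σ_{s_0} ρ)`. [cite: AharonovEtAl2023, Definitions 1–2] -/
def stateCoeff (U : Fin d → Matrix (ι → Bool) (ι → Bool) ℂ) (ρ : Matrix (ι → Bool) (ι → Bool) ℂ)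
    (s : Fin (d + 1) → ι → Pauli) : ℂ :=
  pathCoeff 0 U ρ (pauliString (s (Fin.last d))) s

/-- The framed noisy state in frame `W`, `σ̃_W(γ) := W_d ℰ^{⊗n}(noisyEvolve γ (C_W) ρ) W_d`; its diagonal is
the tree's `p̃_W` (`trace_proj_mul_frameState`). [cite: AharonovEtAl2023, Definitions 2–3] -/
def frameState (γ : ℂ) (U : Fin d → Matrix (ι → Bool) (ι → Bool) ℂ) (ρ : Matrix (ι → Bool) (ι → Bool) ℂ)
    (W : Fin (d + 1) → ι → Pauli) : Matrix (ι → Bool) (ι → Bool) ℂ :=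
  frameObs (depolarizeAll γ (noisyEvolve γ d (frameLayers U W) ρ)) W

/-- The two-rate Hilbert–Schmidt overlap `Tr(σ̃_W(γ₁) σ̃_W(γ₂))` (fidelity with the ideal framed state at
`(0,γ)`, purity at `(γ,γ)`). [folklore] -/
def frameOverlap (γ₁ γ₂ : ℂ) (U : Fin d → Matrix (ι → Bool) (ι → Bool) ℂ)
    (ρ : Matrix (ι → Bool) (ι → Bool) ℂ) (W : Fin (d + 1) → ι → Pauli) : ℂ :=
  (frameState γ₁ U ρ W * frameState γ₂ U ρ W).trace

/-- The state path weight `v_s := g(C,s)²` for the basis input `|y⟩⟨y|` (real, `ofReal_statePathWt`).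
[cite: AharonovEtAl2023, Definition 5 (summand of the Fourier weight)] -/
def statePathWt (U : Fin d → Matrix (ι → Bool) (ι → Bool) ℂ) (y : ι → Bool)
    (s : Fin (d + 1) → ι → Pauli) : ℝ :=
  (stateCoeff U (proj y) s ^ 2).re

/-- The STATE WEIGHT `V_k := Σ_{|s| = k} g(C,s)²` (`W_k ≤ V_k`, `wt_le_stateWt`). [cite: AharonovEtAl2023, Definition 5] -/
def stateWt (U : Fin d → Matrix (ι → Bool) (ι → Bool) ℂ) (y : ι → Bool) (k : ℕ) : ℝ :=
  ∑ s ∈ Finset.univ.filter (fun s : Fin (d + 1) → ι → Pauli => pathWeight s = k), statePathWt U y s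

/-- The STATE ENUMERATOR `Ψ_C(t) := Σ_{k=0}^{n(d+1)} t^k V_k`.
[cite: AharonovEtAl2023, §5 (display before Theorem 4), read for the state] -/
def stateEnumerator (t : ℝ) (U : Fin d → Matrix (ι → Bool) (ι → Bool) ℂ) (y : ι → Bool) : ℝ :=
  ∑ k ∈ Finset.range (Fintype.card ι * (d + 1) + 1), t ^ k * stateWt U y k

/-- Frame-averaged two-rate overlap `E_W Tr(σ̃_W(γ₁) σ̃_W(γ₂))`, basis input. [cite: AharonovEtAl2023, Definition 3] -/
def avgOverlap (γ₁ γ₂ : ℝ) (U : Fin d → Matrix (ι → Bool) (ι → Bool) ℂ) (y : ι → Bool) : ℝ :=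
  (∑ W : Fin (d + 1) → ι → Pauli, frameOverlap (γ₁ : ℂ) (γ₂ : ℂ) U (proj y) W).re / frameCount ι d

/-- Frame-averaged FIDELITY with the ideal framed state, `F̄_γ := E_W Tr(σ̃_W(0) σ̃_W(γ))`. [cite: GaoEtAl2024, §4.2] -/
def avgFid (γ : ℝ) (U : Fin d → Matrix (ι → Bool) (ι → Bool) ℂ) (y : ι → Bool) : ℝ :=
  avgOverlap 0 γ U y

/-- Frame-averaged PURITY `P̄_γ := E_W Tr(σ̃_W(γ)²)`. [folklore] -/
def avgPurity (γ : ℝ) (U : Fin d → Matrix (ι → Bool) (ι → Bool) ℂ) (y : ι → Bool) : ℝ :=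
  avgOverlap γ γ U y

/-- The COHERENCE WEIGHT `Ξ_k := V_k − W_k = Σ_{|s| = k, s_d ∉ {I,Z}ⁿ} g(C,s)²` (`cohWt_eq_sum`). [cite: GaoEtAl2024, §4.2] -/
def cohWt (U : Fin d → Matrix (ι → Bool) (ι → Bool) ℂ) (y x₀ : ι → Bool) (k : ℕ) : ℝ :=
  stateWt U y k - wt U y x₀ k

/-- The COHERENCE ENUMERATOR `Ξ_C(t) := Σ_k t^k Ξ_k = Ψ_C(t) − Φ_C(t)`. [cite: GaoEtAl2024, §4.2] -/
def cohEnumerator (t : ℝ) (U : Fin d → Matrix (ι → Bool) (ι → Bool) ℂ) (y x₀ : ι → Bool) : ℝ :=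
  ∑ k ∈ Finset.range (Fintype.card ι * (d + 1) + 1), t ^ k * cohWt U y x₀ k

section Complex

variable (U : Fin d → Matrix (ι → Bool) (ι → Bool) ℂ) (ρ : Matrix (ι → Bool) (ι → Bool) ℂ)

/-- A scalar on the read-out comes out of the noisy value. [folklore] -/
private theorem noisyValue_smul_obs (γ c : ℂ) (V : Fin d → Matrix (ι → Bool) (ι → Bool) ℂ)
    (O : Matrix (ι → Bool) (ι → Bool) ℂ) : noisyValue γ V ρ (c • O) = c * noisyValue γ V ρ O := by
  simp only [noisyValue, Matrix.smul_mul, Matrix.trace_smul, smul_eq_mul]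

/-- Two framed Pauli read-outs multiply frame-sign free (`W P W = ±P` twice, `(±1)² = 1`; cf. the tree's
`strSign_mul_self` in `OutOfTimeOrderCorrelator`, outside this file's imports). [cite: AharonovEtAl2023, Lemma 3] -/
theorem noisyValue_frameObs_pauli_mul (γ₁ γ₂ : ℂ) (W : Fin (d + 1) → ι → Pauli) (P : ι → Pauli) :
    noisyValue γ₁ (frameLayers U W) ρ (frameObs (pauliString P) W) *
        noisyValue γ₂ (frameLayers U W) ρ (frameObs (pauliString P) W) =
      noisyValue γ₁ (frameLayers U W) ρ (pauliString P) *
        noisyValue γ₂ (frameLayers U W) ρ (pauliString P) := by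
  have hO : frameObs (pauliString P) W = strSign (W (Fin.last d)) P • pauliString P := by
    rw [frameObs, pauliString_conj_eq_strSign_smul]
  have hs : strSign (W (Fin.last d)) P * strSign (W (Fin.last d)) P = 1 := by
    rw [strSign_eq, ← Finset.prod_mul_distrib]
    refine Finset.prod_eq_one fun i _ => ?_
    unfold Pauli.sign
    split_ifs <;> norm_num
  rw [hO, noisyValue_smul_obs, noisyValue_smul_obs, mul_mul_mul_comm, hs, one_mul]

/-- **Factorisation**: for ANY read-out `O`, `f(C,s;O) = 2^{-n} · Tr(O σ_{s_d}) · g(C,s)` (noiseless).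
[cite: AharonovEtAl2023, Definition 2 (the read-out factor ⟨⟨x|s_d⟩⟩ of f(C,s,x))] -/
theorem pathCoeff_zero_eq_trace_mul_stateCoeff (O : Matrix (ι → Bool) (ι → Bool) ℂ)
    (s : Fin (d + 1) → ι → Pauli) :
    pathCoeff 0 U ρ O s = ((2 : ℂ) ^ Fintype.card ι)⁻¹ *
      (O * pauliString (s (Fin.last d))).trace * stateCoeff U ρ s := by
  have h2 : ((2 : ℂ) ^ Fintype.card ι) ≠ 0 := pow_ne_zero _ two_ne_zero
  simp only [stateCoeff, pathCoeff, depolarizeAll_rate_zero, trace_pauliString_mul_pauliString,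
    if_true]
  field_simp

/-- The read-out sum collapses onto `P = s_d`: `Σ_P f̃(C,s;σ_P;γ₁) f̃(C,s;σ_P;γ₂) = ((1−γ₁)(1−γ₂))^{|s|} g(C,s)²`.
[cite: AharonovEtAl2023, §2 (Tr(s s') = 2ⁿ δ_{s,s'}; f̃ = (1−γ)^{|s|} f)] -/
theorem sum_pauli_pathCoeff_mul_pathCoeff (γ₁ γ₂ : ℂ) (s : Fin (d + 1) → ι → Pauli) :
    ∑ P : ι → Pauli, pathCoeff γ₁ U ρ (pauliString P) s * pathCoeff γ₂ U ρ (pauliString P) s =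
      ((1 - γ₁) * (1 - γ₂)) ^ pathWeight s * stateCoeff U ρ s ^ 2 := by
  have h2 : ((2 : ℂ) ^ Fintype.card ι) ≠ 0 := pow_ne_zero _ two_ne_zero
  rw [mul_pow, Finset.sum_eq_single (s (Fin.last d)) (fun P _ hP => by
    rw [pathCoeff_eq_pow_mul_pathCoeff_zero γ₁, pathCoeff_zero_eq_trace_mul_stateCoeff,
      trace_pauliString_mul_pauliString, if_neg hP]; simp) (fun h => (h (Finset.mem_univ _)).elim),
    pathCoeff_eq_pow_mul_pathCoeff_zero γ₁, pathCoeff_eq_pow_mul_pathCoeff_zero γ₂,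
    pathCoeff_zero_eq_trace_mul_stateCoeff, trace_pauliString_mul_pauliString, if_pos rfl,
    inv_mul_cancel₀ h2, one_mul]
  ring

/-- `⟨x| σ̃_W(γ) |x⟩ = p̃_W(x;γ)`: the diagonal of the framed state is the tree's noisy output value.
[cite: AharonovEtAl2023, Definitions 2–3 (p̃(C,x))] -/
theorem trace_proj_mul_frameState (γ : ℂ) (W : Fin (d + 1) → ι → Pauli) (x : ι → Bool) :
    (proj x * frameState γ U ρ W).trace = noisyValue γ (frameLayers U W) ρ (frameObs (proj x) W) := by
  simp only [frameState, frameObs, noisyValue]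
  set M := depolarizeAll γ (noisyEvolve γ d (frameLayers U W) ρ)
  set V := pauliString (W (Fin.last d))
  calc (proj x * (V * M * V)).trace = ((proj x * V * M) * V).trace := by simp only [Matrix.mul_assoc]
    _ = (V * (proj x * V * M)).trace := Matrix.trace_mul_comm _ _
    _ = (V * proj x * V * M).trace := by simp only [Matrix.mul_assoc]

/-- The overlap is frame-free inside the trace (`W_d² = 1`, the last frame is a Pauli string).
[cite: AharonovEtAl2023, Definition 3 (Pauli frames)] -/
theorem frameOverlap_eq (γ₁ γ₂ : ℂ) (W : Fin (d + 1) → ι → Pauli) :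
    frameOverlap γ₁ γ₂ U ρ W = (depolarizeAll γ₁ (noisyEvolve γ₁ d (frameLayers U W) ρ) *
        depolarizeAll γ₂ (noisyEvolve γ₂ d (frameLayers U W) ρ)).trace := by
  simp only [frameOverlap, frameState, frameObs]
  set A := depolarizeAll γ₁ (noisyEvolve γ₁ d (frameLayers U W) ρ)
  set B := depolarizeAll γ₂ (noisyEvolve γ₂ d (frameLayers U W) ρ)
  set V := pauliString (W (Fin.last d))
  have hV : V * V = 1 := pauliString_mul_self _
  calc (V * A * V * (V * B * V)).trace = (V * A * (V * V) * B * V).trace := by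
        simp only [Matrix.mul_assoc]
    _ = ((V * (A * B)) * V).trace := by rw [hV, Matrix.mul_one]; simp only [Matrix.mul_assoc]
    _ = (V * (V * (A * B))).trace := Matrix.trace_mul_comm _ _
    _ = (A * B).trace := by rw [← Matrix.mul_assoc, hV, Matrix.one_mul]

/-! ## (S1) master identity: frame-summed overlaps are the damped state enumerator -/

/-- **`Σ_W Tr(σ̃_W(γ₁) σ̃_W(γ₂)) = (4ⁿ)^{d+1} · 2^{-n} · Σ_s ((1−γ₁)(1−γ₂))^{|s|} g(C,s)²`** (any layer matrices,
input, complex rates): Pauli resolution of the overlap, frame signs cancel per read-out pair, bilinear frame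
orthogonality (`sum_frame_sum_mul_sum_pathCoeff`) per Pauli read-out, collapse onto the last string.
[cite: AharonovEtAl2023, Lemma 3 and §5, read for σ_P] -/
theorem sum_frame_frameOverlap (γ₁ γ₂ : ℂ) :
    ∑ W : Fin (d + 1) → ι → Pauli, frameOverlap γ₁ γ₂ U ρ W =
      ((4 : ℂ) ^ Fintype.card ι) ^ (d + 1) * (((2 : ℂ) ^ Fintype.card ι)⁻¹ *
        ∑ s : Fin (d + 1) → ι → Pauli, ((1 - γ₁) * (1 - γ₂)) ^ pathWeight s * stateCoeff U ρ s ^ 2) := by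
  set c : ℂ := ((4 : ℂ) ^ Fintype.card ι) ^ (d + 1) with hc
  have hres : ∀ W : Fin (d + 1) → ι → Pauli, frameOverlap γ₁ γ₂ U ρ W =
      ((2 : ℂ) ^ Fintype.card ι)⁻¹ * ∑ P : ι → Pauli,
        noisyValue γ₁ (frameLayers U W) ρ (pauliString P) *
          noisyValue γ₂ (frameLayers U W) ρ (pauliString P) := by
    intro W
    rw [frameOverlap_eq, trace_mul_eq_inv_mul_sum]
    congr 1
    refine Finset.sum_congr rfl fun P _ => ?_
    rw [pauliCoeff_eq, Matrix.trace_mul_comm]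
    rfl
  have hP : ∀ P : ι → Pauli, ∑ W : Fin (d + 1) → ι → Pauli,
      noisyValue γ₁ (frameLayers U W) ρ (pauliString P) *
        noisyValue γ₂ (frameLayers U W) ρ (pauliString P) =
      c * ∑ s : Fin (d + 1) → ι → Pauli,
        pathCoeff γ₁ U ρ (pauliString P) s * pathCoeff γ₂ U ρ (pauliString P) s := by
    intro P
    have h := sum_frame_sum_mul_sum_pathCoeff γ₁ γ₂ U ρ (pauliString P) (pauliString P) Finset.univ
    simp only [← noisyValue_eq_sum_pathCoeff, noisyValue_frameObs_pauli_mul] at h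
    exact h
  calc ∑ W : Fin (d + 1) → ι → Pauli, frameOverlap γ₁ γ₂ U ρ W
      = ((2 : ℂ) ^ Fintype.card ι)⁻¹ * ∑ P : ι → Pauli, ∑ W : Fin (d + 1) → ι → Pauli,
          noisyValue γ₁ (frameLayers U W) ρ (pauliString P) *
            noisyValue γ₂ (frameLayers U W) ρ (pauliString P) := by
        simp only [hres, ← Finset.mul_sum]
        rw [Finset.sum_comm]
    _ = ((2 : ℂ) ^ Fintype.card ι)⁻¹ * (c * ∑ s : Fin (d + 1) → ι → Pauli, ∑ P : ι → Pauli,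
          pathCoeff γ₁ U ρ (pauliString P) s * pathCoeff γ₂ U ρ (pauliString P) s) := by
        rw [Finset.sum_congr rfl fun P _ => hP P, ← Finset.mul_sum, Finset.sum_comm]
    _ = c * (((2 : ℂ) ^ Fintype.card ι)⁻¹ * ∑ s : Fin (d + 1) → ι → Pauli,
          ((1 - γ₁) * (1 - γ₂)) ^ pathWeight s * stateCoeff U ρ s ^ 2) := by
        rw [Finset.sum_congr rfl fun s _ => sum_pauli_pathCoeff_mul_pathCoeff U ρ γ₁ γ₂ s]
        ring

end Complex

section Real

variable (U : Fin d → Matrix (ι → Bool) (ι → Bool) ℂ) (y x₀ : ι → Bool)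

/-- `g(C,s)` is real for a basis input. [cite: AharonovEtAl2023, §2 (real Fourier coefficients)] -/
theorem conj_stateCoeff_proj (s : Fin (d + 1) → ι → Pauli) :
    (starRingEnd ℂ) (stateCoeff U (proj y) s) = stateCoeff U (proj y) s :=
  conj_pathCoeff_zero U (conjTranspose_proj y) (conjTranspose_pauliString _) s

/-- `v_s` is the cast of `g(C,s)²`. [cite: AharonovEtAl2023, Definition 5] -/
theorem ofReal_statePathWt (s : Fin (d + 1) → ι → Pauli) :
    ((statePathWt U y s : ℝ) : ℂ) = stateCoeff U (proj y) s ^ 2 :=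
  Complex.conj_eq_iff_re.mp (by rw [map_pow, conj_stateCoeff_proj])

/-- `v_s ≥ 0` (the square of a real number). [cite: AharonovEtAl2023, Definition 5] -/
theorem statePathWt_nonneg (s : Fin (d + 1) → ι → Pauli) : 0 ≤ statePathWt U y s := by
  obtain ⟨t, ht⟩ : ∃ t : ℝ, (t : ℂ) = stateCoeff U (proj y) s :=
    ⟨_, Complex.conj_eq_iff_re.mp (conj_stateCoeff_proj U y s)⟩
  rw [statePathWt, ← ht, ← Complex.ofReal_pow, Complex.ofReal_re]
  positivity

/-- `V_k ≥ 0`. [cite: AharonovEtAl2023, Definition 5] -/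
theorem stateWt_nonneg (k : ℕ) : 0 ≤ stateWt U y k :=
  Finset.sum_nonneg fun s _ => statePathWt_nonneg U y s

omit [Fintype ι] [DecidableEq ι] in
/-- A diagonal entry of a one-qubit Pauli matrix times itself is `[Q ∈ {I, Z}]`. [folklore] -/
private theorem mat_apply_self_mul_self (Q : Pauli) (b : Bool) :
    Q.mat b b * Q.mat b b = if (Q = Pauli.I ∨ Q = Pauli.Z) then 1 else 0 := by
  cases Q <;> cases b <;> simp

/-- The squared read-out bracket is the `Z`-type indicator: `Tr(|x⟩⟨x| σ_S)² = [S ∈ {I,Z}ⁿ]`.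
[cite: AharonovEtAl2023, §2 (legal paths end in {I,Z}-strings)] -/
theorem trace_proj_mul_pauliString_sq_eq_ite (x : ι → Bool) (S : ι → Pauli) :
    (proj x * pauliString S).trace ^ 2 = if (∀ i, S i = Pauli.I ∨ S i = Pauli.Z) then 1 else 0 := by
  rw [trace_proj_mul, pauliString_eq, tensorAll_apply, sq, ← Finset.prod_mul_distrib]
  simp_rw [mat_apply_self_mul_self]
  rw [Finset.prod_boole]
  simp

/-- **`w_s = [s_d ∈ {I,Z}ⁿ] · v_s`** — the tree's XEB path weight is the `Z`-type part of the state path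
weight (any reference output `x₀`). [cite: AharonovEtAl2023, Definition 5 and §2 ("x only affects the sign")] -/
theorem pathWt_eq_ite_statePathWt (s : Fin (d + 1) → ι → Pauli) :
    pathWt U y x₀ s =
      if (∀ i, s (Fin.last d) i = Pauli.I ∨ s (Fin.last d) i = Pauli.Z) then statePathWt U y s else 0 := by
  have h2 : ((2 : ℂ) ^ Fintype.card ι) ≠ 0 := pow_ne_zero _ two_ne_zero
  have key : ((pathWt U y x₀ s : ℝ) : ℂ) =
      (if (∀ i, s (Fin.last d) i = Pauli.I ∨ s (Fin.last d) i = Pauli.Z) then (1 : ℂ) else 0) *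
        ((statePathWt U y s : ℝ) : ℂ) := by
    rw [ofReal_pathWt, ofReal_statePathWt, pathCoeff_zero_eq_trace_mul_stateCoeff,
      ← trace_proj_mul_pauliString_sq_eq_ite x₀ (s (Fin.last d))]
    field_simp
  split_ifs at key ⊢ <;> simp only [one_mul, zero_mul] at key <;> exact_mod_cast key

/-- **`W_k ≤ V_k`** degree by degree. [cite: GaoEtAl2024, §4.2 ("only … the computational basis")] -/
theorem wt_le_stateWt (k : ℕ) : wt U y x₀ k ≤ stateWt U y k := by
  rw [wt_eq_sum_pathWt]
  refine Finset.sum_le_sum fun s _ => ?_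
  rw [pathWt_eq_ite_statePathWt]
  split_ifs
  · exact le_rfl
  · exact statePathWt_nonneg U y s

/-- `Ξ_k ≥ 0`. [cite: GaoEtAl2024, §4.2] -/
theorem cohWt_nonneg (k : ℕ) : 0 ≤ cohWt U y x₀ k := sub_nonneg.2 (wt_le_stateWt U y x₀ k)

/-- **`Ξ_k = Σ_{|s| = k, s_d ∉ {I,Z}ⁿ} g(C,s)²`** — carried exactly by the paths whose last string is NOT of
`Z`-type (invisible to every computational-basis read-out). [cite: GaoEtAl2024, §4.2 (v_F − v_XEB)] -/
theorem cohWt_eq_sum (k : ℕ) :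
    cohWt U y x₀ k = ∑ s ∈ (Finset.univ.filter (fun s : Fin (d + 1) → ι → Pauli => pathWeight s = k)).filter
      (fun s => ¬ (∀ i, s (Fin.last d) i = Pauli.I ∨ s (Fin.last d) i = Pauli.Z)), statePathWt U y s := by
  rw [cohWt, stateWt, wt_eq_sum_pathWt, ← Finset.sum_filter_add_sum_filter_not
    (Finset.univ.filter (fun s : Fin (d + 1) → ι → Pauli => pathWeight s = k))
    (fun s => ∀ i, s (Fin.last d) i = Pauli.I ∨ s (Fin.last d) i = Pauli.Z) (statePathWt U y)]
  simp only [pathWt_eq_ite_statePathWt, Finset.sum_ite, Finset.sum_const_zero, add_zero]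
  ring

/-! ## (S1) real form: frame-averaged overlap, fidelity and purity are the state enumerator -/

/-- **`E_W Tr(σ̃_W(γ₁) σ̃_W(γ₂)) = 2^{-n} Ψ_C((1−γ₁)(1−γ₂))`** (any layer matrices, basis input, real rates).
[cite: AharonovEtAl2023, Lemma 3 and §5 (display before Theorem 4), read for the state] -/
theorem avgOverlap_eq (γ₁ γ₂ : ℝ) :
    avgOverlap γ₁ γ₂ U y = ((2 : ℝ) ^ Fintype.card ι)⁻¹ * stateEnumerator ((1 - γ₁) * (1 - γ₂)) U y := by
  have hF := frameCount_pos ι d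
  have hgroup : ∑ s : Fin (d + 1) → ι → Pauli,
      ((1 - (γ₁ : ℂ)) * (1 - (γ₂ : ℂ))) ^ pathWeight s * stateCoeff U (proj y) s ^ 2 =
      ∑ k ∈ Finset.range (Fintype.card ι * (d + 1) + 1), ((1 - (γ₁ : ℂ)) * (1 - (γ₂ : ℂ))) ^ k *
        ∑ s ∈ Finset.univ.filter (fun s : Fin (d + 1) → ι → Pauli => pathWeight s = k),
          stateCoeff U (proj y) s ^ 2 := by
    simp only [Finset.mul_sum]
    rw [← Finset.sum_fiberwise_of_maps_to (s := Finset.univ)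
      (t := Finset.range (Fintype.card ι * (d + 1) + 1)) (g := fun s => pathWeight s)
      (fun s _ => Finset.mem_range.2 (Nat.lt_succ_of_le (pathWeight_le s)))]
    refine Finset.sum_congr rfl fun k _ => Finset.sum_congr rfl fun s hs => ?_
    rw [(Finset.mem_filter.1 hs).2]
  have hR : ((frameCount ι d * (((2 : ℝ) ^ Fintype.card ι)⁻¹ *
      stateEnumerator ((1 - γ₁) * (1 - γ₂)) U y) : ℝ) : ℂ) =
      ((4 : ℂ) ^ Fintype.card ι) ^ (d + 1) * (((2 : ℂ) ^ Fintype.card ι)⁻¹ *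
        ∑ s : Fin (d + 1) → ι → Pauli, ((1 - (γ₁ : ℂ)) * (1 - (γ₂ : ℂ))) ^ pathWeight s *
          stateCoeff U (proj y) s ^ 2) := by
    rw [hgroup]
    unfold frameCount stateEnumerator stateWt
    push_cast
    simp_rw [ofReal_statePathWt]
  rw [avgOverlap, sum_frame_frameOverlap U (proj y) (γ₁ : ℂ) (γ₂ : ℂ), ← hR, Complex.ofReal_re]
  field_simp

/-- **`F̄_γ = 2^{-n} Ψ_C(1−γ)`**. [cite: GaoEtAl2024, §4.2 (fidelity as a path sum with boundary v_F)] -/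
theorem avgFid_eq (γ : ℝ) : avgFid γ U y = ((2 : ℝ) ^ Fintype.card ι)⁻¹ * stateEnumerator (1 - γ) U y := by
  rw [avgFid, avgOverlap_eq, sub_zero, one_mul]

/-- **`P̄_γ = 2^{-n} Ψ_C((1−γ)²)`** (equal rates in `avgOverlap_eq`; `P̄_γ − 2⁻ⁿ` = frame-averaged squared HS distance
to `𝟙/2ⁿ`, bounded via `stateEnumerator_sandwich` at `t = (1−γ)²`). [cite: AharonovEtAl2023, §5, read for the state] -/
theorem avgPurity_eq (γ : ℝ) :
    avgPurity γ U y = ((2 : ℝ) ^ Fintype.card ι)⁻¹ * stateEnumerator ((1 - γ) ^ 2) U y := by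
  rw [avgPurity, avgOverlap_eq, sq]

/-! ## (S2) the split `2ⁿ F̄_γ = (E_W XEB_γ + 1) + Ξ_C(1−γ)` -/

/-- `Ψ_C = Φ_C + Ξ_C`. [cite: GaoEtAl2024, §4.2] -/
theorem stateEnumerator_eq_add (t : ℝ) :
    stateEnumerator t U y = weightEnumerator t U y x₀ + cohEnumerator t U y x₀ := by
  unfold stateEnumerator weightEnumerator cohEnumerator cohWt
  rw [← Finset.sum_add_distrib]
  exact Finset.sum_congr rfl fun k _ => by ring

/-- **FIDELITY–XEB SPLIT** `2ⁿ · F̄_γ = (E_W XEB_γ + 1) + Ξ_C(1 − γ)` (any layer matrices, basis input, real `γ`,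
any `x₀`): the fidelity sees every Pauli path, the XEB only those ending in `Z`-type strings.
[cite: GaoEtAl2024, §4.2 ("differ only by the boundary condition at the final time")] -/
theorem two_pow_mul_avgFid_eq (γ : ℝ) :
    (2 : ℝ) ^ Fintype.card ι * avgFid γ U y = (avgXEB γ U y + 1) + cohEnumerator (1 - γ) U y x₀ := by
  rw [avgFid_eq, stateEnumerator_eq_add U y x₀ (1 - γ), avgXEB_add_one_eq_weightEnumerator γ U y x₀]
  have h2 : ((2 : ℝ) ^ Fintype.card ι) ≠ 0 := pow_ne_zero _ two_ne_zero
  field_simp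

/-- `Ξ_C(t) ≥ 0` for `t ≥ 0`. [cite: GaoEtAl2024, §4.2] -/
theorem cohEnumerator_nonneg {t : ℝ} (ht : 0 ≤ t) : 0 ≤ cohEnumerator t U y x₀ :=
  Finset.sum_nonneg fun k _ => mul_nonneg (pow_nonneg ht k) (cohWt_nonneg U y x₀ k)

/-- **`E_W XEB_γ + 1 ≤ 2ⁿ F̄_γ`** for `γ ≤ 1` (any layer matrices, basis input). [cite: GaoEtAl2024, §4.2] -/
theorem avgXEB_add_one_le (γ : ℝ) (hγ : γ ≤ 1) :
    avgXEB γ U y + 1 ≤ (2 : ℝ) ^ Fintype.card ι * avgFid γ U y := by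
  rw [two_pow_mul_avgFid_eq U y y γ]
  linarith [cohEnumerator_nonneg U y y (sub_nonneg.2 hγ)]

/-- **Equality case `d = 0`** (prepare, noise, measure): `Ξ_k = 0` — a path ending off the diagonal STARTS
off the diagonal, and `Tr(σ_{s_0} |y⟩⟨y|) = 0`. [cite: GaoEtAl2024, §4.2; AharonovEtAl2023, §2 (legal paths)] -/
theorem cohWt_eq_zero_of_depth_zero (U : Fin 0 → Matrix (ι → Bool) (ι → Bool) ℂ) (k : ℕ) :
    cohWt U y x₀ k = 0 := by
  rw [cohWt_eq_sum]
  refine Finset.sum_eq_zero fun s hs => ?_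
  have hnz := (Finset.mem_filter.1 hs).2
  simp only [not_forall, not_or] at hnz
  obtain ⟨i, hiI, hiZ⟩ := hnz
  have hi : s 0 i = Pauli.X ∨ s 0 i = Pauli.Y := by
    rw [show (Fin.last 0 : Fin 1) = 0 from rfl] at hiI hiZ
    cases h : s 0 i <;> simp_all
  rw [statePathWt, stateCoeff, pathCoeff, trace_pauliString_mul_proj_eq_zero hi]
  simp

/-- At `d = 0`: `2ⁿ F̄_γ = E_W XEB_γ + 1`. [cite: GaoEtAl2024, §4.2] -/
theorem two_pow_mul_avgFid_eq_of_depth_zero (γ : ℝ) (U : Fin 0 → Matrix (ι → Bool) (ι → Bool) ℂ) :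
    (2 : ℝ) ^ Fintype.card ι * avgFid γ U y = avgXEB γ U y + 1 := by
  rw [two_pow_mul_avgFid_eq U y y γ, cohEnumerator]
  simp [cohWt_eq_zero_of_depth_zero]

end Real

section Unitary

variable {U : Fin d → Matrix (ι → Bool) (ι → Bool) ℂ} (hU : ∀ t, U t ∈ Matrix.unitaryGroup (ι → Bool) ℂ)
  (y x₀ : ι → Bool)
include hU

/-! ## (S3) legality and normalisation of the state weights (unitary layers) -/

/-- `v_{I…I} = 1` (the trivial path carries `Tr(1) Tr(ρ)/2ⁿ = 1`). [cite: AharonovEtAl2023, Lemma 4 (item 1)] -/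
theorem statePathWt_const_I : statePathWt U y (fun _ _ => Pauli.I) = 1 := by
  have h : stateCoeff U (proj y) (fun _ _ => Pauli.I) = 1 := by
    have h2 : ((2 : ℂ) ^ Fintype.card ι) ≠ 0 := pow_ne_zero _ two_ne_zero
    rw [stateCoeff, pathCoeff_const_I 0 hU]
    simp only [pauliString_const_I, Matrix.trace_one, Fintype.card_fun, Fintype.card_bool, trace_proj]
    push_cast
    field_simp
  simp [statePathWt, h]

/-- `v_s = 0` for `1 ≤ |s| ≤ d`. [cite: AharonovEtAl2023, Lemma 4 (item 2)] -/
theorem statePathWt_eq_zero_of_le {s : Fin (d + 1) → ι → Pauli} (hs0 : pathWeight s ≠ 0)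
    (hsd : pathWeight s ≤ d) : statePathWt U y s = 0 := by
  have hc : stateCoeff U (proj y) s = 0 := by
    by_contra hne
    rcases pathWeight_eq_zero_or_lt_of_pathCoeff_ne_zero 0 hU (proj y)
      (pauliString (s (Fin.last d))) hne with h0 | hlt
    · exact hs0 h0
    · omega
  simp [statePathWt, hc]

/-- **`V_0 = 1`**. [cite: AharonovEtAl2023, Lemma 4 (item 1)] -/
theorem stateWt_zero : stateWt U y 0 = 1 := by
  have hfil : Finset.univ.filter (fun s : Fin (d + 1) → ι → Pauli => pathWeight s = 0) =
      {fun _ _ => Pauli.I} := by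
    ext s
    simp [pathWeight_eq_zero_iff]
  rw [stateWt, hfil, Finset.sum_singleton, statePathWt_const_I hU]

/-- **`V_k = 0` for `0 < k ≤ d`**. [cite: AharonovEtAl2023, Lemma 4 (item 2)] -/
theorem stateWt_eq_zero_of_le {k : ℕ} (hk0 : k ≠ 0) (hkd : k ≤ d) : stateWt U y k = 0 := by
  refine Finset.sum_eq_zero fun s hs => ?_
  have hk : pathWeight s = k := (Finset.mem_filter.1 hs).2
  exact statePathWt_eq_zero_of_le hU y (hk ▸ hk0) (hk ▸ hkd)

/-- `Ξ_k = 0` for `k ≤ d` (`V_k`, `W_k` both legal). [cite: AharonovEtAl2023, Lemma 4 (items 1–2)] -/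
theorem cohWt_eq_zero_of_le {k : ℕ} (hkd : k ≤ d) : cohWt U y x₀ k = 0 := by
  by_cases hk0 : k = 0
  · subst hk0; rw [cohWt, stateWt_zero hU, wt_zero hU, sub_self]
  · rw [cohWt, stateWt_eq_zero_of_le hU y hk0 hkd, wt_eq_zero_of_le hU y x₀ hk0 hkd, sub_self]

omit hU in
/-- Conjugation by a unitary preserves `Tr(M²)`. [folklore] -/
private theorem trace_unitaryConj_mul_self {V : Matrix (ι → Bool) (ι → Bool) ℂ}
    (hV : V ∈ Matrix.unitaryGroup (ι → Bool) ℂ) (M : Matrix (ι → Bool) (ι → Bool) ℂ) :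
    ((V * M * Vᴴ) * (V * M * Vᴴ)).trace = (M * M).trace := by
  have hVV : Vᴴ * V = 1 := by
    simpa only [Matrix.star_eq_conjTranspose] using Matrix.mem_unitaryGroup_iff'.mp hV
  calc ((V * M * Vᴴ) * (V * M * Vᴴ)).trace = (V * (M * (Vᴴ * V) * M) * Vᴴ).trace := by
        simp only [Matrix.mul_assoc]
    _ = ((V * (M * M)) * Vᴴ).trace := by rw [hVV, Matrix.mul_one]
    _ = (Vᴴ * (V * (M * M))).trace := Matrix.trace_mul_comm _ _
    _ = (M * M).trace := by rw [← Matrix.mul_assoc, hVV, Matrix.one_mul]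

omit hU in
/-- Noiseless evolution by unitary layers preserves `Tr(ρ²)`. [folklore] -/
private theorem trace_noisyEvolve_zero_mul_self : ∀ (d : ℕ) {U : Fin d → Matrix (ι → Bool) (ι → Bool) ℂ}
    (_ : ∀ t, U t ∈ Matrix.unitaryGroup (ι → Bool) ℂ) (ρ : Matrix (ι → Bool) (ι → Bool) ℂ),
    (noisyEvolve 0 d U ρ * noisyEvolve 0 d U ρ).trace = (ρ * ρ).trace := by
  intro d
  induction d with
  | zero => intro U _ ρ; rfl
  | succ d ih =>
    intro U hU ρ
    rw [noisyEvolve_succ_layers, depolarizeAll_rate_zero, trace_unitaryConj_mul_self (hU (Fin.last d)),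
      ih (fun i => hU i.castSucc)]

/-- The ideal framed state is pure: `Tr(σ̃_W(0)²) = 1` (basis input). [folklore] -/
private theorem frameOverlap_zero_zero (W : Fin (d + 1) → ι → Pauli) : frameOverlap 0 0 U (proj y) W = 1 := by
  rw [frameOverlap_eq, depolarizeAll_rate_zero,
    trace_noisyEvolve_zero_mul_self d (frameLayers_mem_unitaryGroup hU W) (proj y), trace_proj_mul]
  simp

/-- **`Ψ_C(1) = Σ_k V_k = 2ⁿ`** (basis input; `= 2ⁿ Tr(ρ²)`). [cite: AharonovEtAl2023, Lemma 4, read for the state] -/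
theorem stateEnumerator_one : stateEnumerator 1 U y = (2 : ℝ) ^ Fintype.card ι := by
  have hF := frameCount_pos ι d
  have h2 : ((2 : ℝ) ^ Fintype.card ι) ≠ 0 := pow_ne_zero _ two_ne_zero
  have h1 : avgOverlap 0 0 U y = 1 := by
    rw [avgOverlap]
    simp only [Complex.ofReal_zero, frameOverlap_zero_zero hU y, Finset.sum_const, Finset.card_univ,
      nsmul_eq_mul, mul_one, Complex.natCast_re]
    rw [card_frame_eq (ι := ι) d, div_self hF.ne']
  have h := avgOverlap_eq U y 0 0
  rw [h1, sub_zero, mul_one] at h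
  field_simp at h
  linarith

/-! ## Sandwiches (unitary layers, `0 ≤ t ≤ 1` visible): coherence band and floor-regime rows -/

omit hU in
omit [DecidableEq ι] [Fintype ι] in
/-- Engine: a nonnegative sequence vanishing in degrees `1…d`, damped by `t^k`, `0 ≤ t ≤ 1`. [folklore] -/
private theorem damped_sum_sandwich {N d : ℕ} (a : ℕ → ℝ) (ha : ∀ k, 0 ≤ a k)
    (hz : ∀ k, k ≠ 0 → k ≤ d → a k = 0) {t : ℝ} (ht0 : 0 ≤ t) (ht1 : t ≤ 1) :
    t ^ N * ∑ k ∈ (Finset.range (N + 1)).erase 0, a k ≤ ∑ k ∈ (Finset.range (N + 1)).erase 0, t ^ k * a k ∧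
      ∑ k ∈ (Finset.range (N + 1)).erase 0, t ^ k * a k ≤
        t ^ (d + 1) * ∑ k ∈ (Finset.range (N + 1)).erase 0, a k := by
  rw [Finset.mul_sum, Finset.mul_sum]
  refine ⟨Finset.sum_le_sum fun k hk => ?_, Finset.sum_le_sum fun k hk => ?_⟩
  · have hkN : k ≤ N := Nat.lt_succ_iff.1 (Finset.mem_range.1 (Finset.mem_erase.1 hk).2)
    exact mul_le_mul_of_nonneg_right (pow_le_pow_of_le_one ht0 ht1 hkN) (ha k)
  · have hk0 : k ≠ 0 := (Finset.mem_erase.1 hk).1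
    by_cases hkd : k ≤ d
    · rw [hz k hk0 hkd, mul_zero, mul_zero]
    · exact mul_le_mul_of_nonneg_right (pow_le_pow_of_le_one ht0 ht1 (by omega)) (ha k)

/-- `Ψ_C(t) = 1 + Σ_{k ≥ 1} t^k V_k`. [cite: AharonovEtAl2023, Lemma 4 (item 1)] -/
theorem stateEnumerator_eq_one_add (t : ℝ) : stateEnumerator t U y =
    1 + ∑ k ∈ (Finset.range (Fintype.card ι * (d + 1) + 1)).erase 0, t ^ k * stateWt U y k := by
  rw [stateEnumerator, ← Finset.add_sum_erase _ _ (Finset.mem_range.2 (Nat.succ_pos _)), pow_zero,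
    one_mul, stateWt_zero hU y]

/-- `Ξ_C(t) = Σ_{k ≥ 1} t^k Ξ_k` (`Ξ_0 = 0`). [cite: AharonovEtAl2023, Lemma 4 (item 1)] -/
theorem cohEnumerator_eq_sum_erase (t : ℝ) : cohEnumerator t U y x₀ =
    ∑ k ∈ (Finset.range (Fintype.card ι * (d + 1) + 1)).erase 0, t ^ k * cohWt U y x₀ k := by
  rw [cohEnumerator, ← Finset.add_sum_erase _ _ (Finset.mem_range.2 (Nat.succ_pos _)),
    cohWt_eq_zero_of_le hU y x₀ (Nat.zero_le d), mul_zero, zero_add]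

/-- `Ξ_C(1) = 2ⁿ − 1 − α′`, `α′ = E_W XEB_0`: the total coherence weight is the IDEAL-XEB DEFICIT. [cite: GaoEtAl2024, §4.2] -/
theorem cohEnumerator_one : cohEnumerator 1 U y x₀ = (2 : ℝ) ^ Fintype.card ι - 1 - avgXEB 0 U y := by
  have h := stateEnumerator_eq_add U y x₀ 1
  rw [stateEnumerator_one hU y, ← sub_zero (1 : ℝ), ← avgXEB_add_one_eq_weightEnumerator 0 U y x₀] at h
  simp only [sub_zero] at h
  linarith

/-- **COHERENCE BAND** `t^{n(d+1)} (2ⁿ − 1 − α′) ≤ Ξ_C(t) ≤ t^{d+1} (2ⁿ − 1 − α′)` (unitary layers, `0 ≤ t ≤ 1`):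
the coherence term is pinned by the ideal-XEB deficit up to the exponents `d+1` / `n(d+1)` (`Ξ ≡ 0` iff
`α′ = 2ⁿ − 1`). [cite: GaoEtAl2024, §4.2; AharonovEtAl2023, Theorem 4 (proof: the two exponents)] -/
theorem cohEnumerator_sandwich {t : ℝ} (ht0 : 0 ≤ t) (ht1 : t ≤ 1) :
    t ^ (Fintype.card ι * (d + 1)) * ((2 : ℝ) ^ Fintype.card ι - 1 - avgXEB 0 U y) ≤
        cohEnumerator t U y x₀ ∧
      cohEnumerator t U y x₀ ≤ t ^ (d + 1) * ((2 : ℝ) ^ Fintype.card ι - 1 - avgXEB 0 U y) := by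
  have htot : ∑ k ∈ (Finset.range (Fintype.card ι * (d + 1) + 1)).erase 0, cohWt U y x₀ k =
      (2 : ℝ) ^ Fintype.card ι - 1 - avgXEB 0 U y := by
    rw [← cohEnumerator_one hU y x₀, cohEnumerator_eq_sum_erase hU y x₀ 1]
    simp only [one_pow, one_mul]
  rw [← htot, cohEnumerator_eq_sum_erase hU y x₀ t]
  exact damped_sum_sandwich (cohWt U y x₀) (cohWt_nonneg U y x₀)
    (fun k hk0 hkd => cohWt_eq_zero_of_le hU y x₀ hkd) ht0 ht1

/-- **The split with its band** (unitary layers, `0 ≤ γ ≤ 1`):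
`(E_W XEB_γ + 1) + (1−γ)^{n(d+1)} (2ⁿ−1−α′) ≤ 2ⁿ F̄_γ ≤ (E_W XEB_γ + 1) + (1−γ)^{d+1} (2ⁿ−1−α′)`.
[cite: GaoEtAl2024, §4.2; AharonovEtAl2023, Theorem 4 (proof)] -/
theorem two_pow_mul_avgFid_band {γ : ℝ} (h0 : 0 ≤ γ) (h1 : γ ≤ 1) :
    (avgXEB γ U y + 1) + (1 - γ) ^ (Fintype.card ι * (d + 1)) * ((2 : ℝ) ^ Fintype.card ι - 1 - avgXEB 0 U y)
        ≤ (2 : ℝ) ^ Fintype.card ι * avgFid γ U y ∧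
      (2 : ℝ) ^ Fintype.card ι * avgFid γ U y ≤
        (avgXEB γ U y + 1) + (1 - γ) ^ (d + 1) * ((2 : ℝ) ^ Fintype.card ι - 1 - avgXEB 0 U y) := by
  have h := cohEnumerator_sandwich hU y y (t := 1 - γ) (by linarith) (by linarith)
  rw [two_pow_mul_avgFid_eq U y y γ]
  exact ⟨by linarith [h.1], by linarith [h.2]⟩

/-- `1 + t^{n(d+1)} (2ⁿ − 1) ≤ Ψ_C(t) ≤ 1 + t^{d+1} (2ⁿ − 1)` for `0 ≤ t ≤ 1`.
[cite: AharonovEtAl2023, Theorem 4 (proof) and Lemma 4, read for the state] -/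
theorem stateEnumerator_sandwich {t : ℝ} (ht0 : 0 ≤ t) (ht1 : t ≤ 1) :
    1 + t ^ (Fintype.card ι * (d + 1)) * ((2 : ℝ) ^ Fintype.card ι - 1) ≤ stateEnumerator t U y ∧
      stateEnumerator t U y ≤ 1 + t ^ (d + 1) * ((2 : ℝ) ^ Fintype.card ι - 1) := by
  have htot : ∑ k ∈ (Finset.range (Fintype.card ι * (d + 1) + 1)).erase 0, stateWt U y k =
      (2 : ℝ) ^ Fintype.card ι - 1 := by
    have h := stateEnumerator_eq_one_add hU y 1
    simp only [one_pow, one_mul, stateEnumerator_one hU y] at h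
    linarith
  rw [← htot, stateEnumerator_eq_one_add hU y t]
  have h := damped_sum_sandwich (stateWt U y) (stateWt_nonneg U y)
    (fun k hk0 hkd => stateWt_eq_zero_of_le hU y hk0 hkd) ht0 ht1 (N := Fintype.card ι * (d + 1))
  exact ⟨by linarith [h.1], by linarith [h.2]⟩

/-- FLOOR-REGIME FIDELITY SANDWICH `2⁻ⁿ + (1−2⁻ⁿ)(1−γ)^{n(d+1)} ≤ F̄_γ ≤ 2⁻ⁿ + (1−2⁻ⁿ)(1−γ)^{d+1}` (`0 ≤ γ ≤ 1`;
informative only near the decohered floor `2⁻ⁿ`). [cite: AharonovEtAl2023, Theorem 4 (proof), read for the state] -/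
theorem avgFid_sandwich {γ : ℝ} (h0 : 0 ≤ γ) (h1 : γ ≤ 1) :
    ((2 : ℝ) ^ Fintype.card ι)⁻¹ + (1 - ((2 : ℝ) ^ Fintype.card ι)⁻¹) * (1 - γ) ^ (Fintype.card ι * (d + 1))
        ≤ avgFid γ U y ∧
      avgFid γ U y ≤ ((2 : ℝ) ^ Fintype.card ι)⁻¹ + (1 - ((2 : ℝ) ^ Fintype.card ι)⁻¹) * (1 - γ) ^ (d + 1) := by
  have h2 : (0 : ℝ) < (2 : ℝ) ^ Fintype.card ι := by positivity
  have h := stateEnumerator_sandwich hU y (t := 1 - γ) (by linarith) (by linarith)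
  rw [avgFid_eq]
  constructor
  · calc _ = ((2 : ℝ) ^ Fintype.card ι)⁻¹ *
          (1 + (1 - γ) ^ (Fintype.card ι * (d + 1)) * ((2 : ℝ) ^ Fintype.card ι - 1)) := by
          field_simp
      _ ≤ _ := mul_le_mul_of_nonneg_left h.1 (inv_nonneg.2 h2.le)
  · calc _ ≤ ((2 : ℝ) ^ Fintype.card ι)⁻¹ * (1 + (1 - γ) ^ (d + 1) * ((2 : ℝ) ^ Fintype.card ι - 1)) :=
          mul_le_mul_of_nonneg_left h.2 (inv_nonneg.2 h2.le)
      _ = _ := by field_simp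

end Unitary

/-- Readings at `n = 53`, `d + 1 = 20`, `γ = 1/200`: ceiling factor `(1−γ)^{d+1} ∈ (0.9046, 0.9047)`, floor
factor `(1−γ)^{n(d+1)} = ((1−γ)^{20})^{53} ∈ (0.0049, 0.0050)` — `Ξ_C(1−γ)` lies between `0.49 %` and `90.5 %`
of the ideal-XEB deficit `2⁵³ − 1 − α′`; `n = 53` and `20` cycles are the parameters printed in
[cite: AruteEtAl2019, Fig. 4] (the rate `1/200` is illustrative, not a reported error budget). -/
theorem numbers : (0.9046 : ℝ) < (1 - 1 / 200) ^ 20 ∧ ((1 : ℝ) - 1 / 200) ^ 20 < 0.9047 ∧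
    (0.0049 : ℝ) < 0.9046 ^ 53 ∧ (0.9047 : ℝ) ^ 53 < 0.0050 := by
  norm_num

end PauliPath.StateEnumerator

end Literature.Computability.QuantumComplexity
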